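import Literature.Barriers.CriticalPhenomena.WeaklySAWCriticalNuLowerBound
import Literature.Barriers.CriticalPhenomena.WeaklySAWSubmultiplicativity
import Literature.Barriers.CriticalPhenomena.WeaklySAWCriticalNuRGReduction
import HarnessLib

/-!
# Lemma A.1 of Bauerschmidt–Brydges–Slade 2015 (`CTWSAW.BBS2015_lemA1`) discharged

The named fact `CTWSAW.BBS2015_lemA1` of `WeaklySAWFourDimLogCorrections.lean` transcribes
**Lemma A.1** (Appendix A, "Existence of critical value") of R. Bauerschmidt, D. C. Brydges,
G. Slade, CMP 337 (2015), arXiv:1403.7422: for all `d > 0` (and `g > 0`) there is a critical value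
`ν_c ∈ (-∞, 0]` with `χ(g,ν) < ∞ ↔ ν > ν_c`, and for `d > 2`, `ν_c ∈ [-2C₀(0)g, 0]`. All three of
its clauses are proved in the tree, in files that import the barrier file (so the discharge cannot
be appended there): `ν_c ≤ 0` (`criticalNu_le_zero`, `…Proofs.lean`), `χ(g,ν) < ∞ ↔ ν > ν_c`
(`susceptibility_lt_top_iff`, `WeaklySAWSubmultiplicativity.lean`, from `c_{T+S} ≤ c_T c_S`), and the
`d > 2` clause `-2C₀(0)g ≤ ν_c` (`BBS2015_lemA1_clause_dgt2`, `WeaklySAWCriticalNuLowerBound.lean`: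
Jensen's inequality in the jump-chain representation, `E I(T) ≤ 2TC₀(0)`, and transience of simple
random walk for `d ≥ 3`). This file only assembles them:

* `CTWSAW.BBS2015_lemA1_holds : BBS2015_lemA1` — the named fact is now a theorem;
* `CTWSAW.BBS2015_thm12_of_thm41_nu0c'` — the hypothesis-free form of the tree's
  `BBS2015_thm12_of_thm41_nu0c_of_lemA1`: Theorem 1.2 from the renormalisation-group fact
  `BBS2015_thm41_nu0c` alone. (Theorem 1.1, i.e. the barrier `WeaklySAWFourDimLogCorrections`, from
  Theorem 4.1 alone is already `BBS2015_thm41.thm11` / `BBS2015_thm41.barrier` in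
  `…CesaroAssembly.lean`, by a route that needs only the clause `χ < ∞ ↔ ν > ν_c`.)

## References
* Bauerschmidt–Brydges–Slade 2015, Appendix A, Lemma A.1; Theorem 1.2, §8.5.
  [BauerschmidtBrydgesSlade2015LogCorr]
-/

namespace Literature.Barriers.CriticalPhenomena

namespace CTWSAW

/-- **Lemma A.1 of Bauerschmidt–Brydges–Slade 2015, proved** (discharge of the named fact
`BBS2015_lemA1`): for every `d > 0` and `g > 0`, `ν_c(d,g) ≤ 0` and `χ(g,ν) < ∞ ↔ ν > ν_c(d,g)`;
for `d > 2`, `-2C₀(0)g ≤ ν_c(d,g)`. [cite: BauerschmidtBrydgesSlade2015LogCorr, Lemma A.1] -/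
theorem BBS2015_lemA1_holds : BBS2015_lemA1 := fun _d hd _g hg =>
  ⟨⟨criticalNu_le_zero hg.le _, fun ν => susceptibility_lt_top_iff hd hg.le ν⟩,
    fun hd2 => (BBS2015_lemA1_clause_dgt2 hd2 hg).1⟩

/-- **Theorem 1.2 from the renormalisation-group fact alone**: `BBS2015_thm41_nu0c → BBS2015_thm12`
(`BBS2015_thm12_of_thm41_nu0c_of_lemA1` with Lemma A.1 discharged).
[cite: BauerschmidtBrydgesSlade2015LogCorr, Theorem 1.2, §8.5 and Lemma A.1] -/
theorem BBS2015_thm12_of_thm41_nu0c' (h : BBS2015_thm41_nu0c) : BBS2015_thm12 :=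
  BBS2015_thm12_of_thm41_nu0c_of_lemA1 h BBS2015_lemA1_holds

end CTWSAW

end Literature.Barriers.CriticalPhenomena
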